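/-
Copyright (c) 2026 the pub-hodgecm-mathlib formalisation cell (harness21).  Prover seat hodgecm-mathlib-LH7-p05 (g4): Track B «K2-LIT»,
hLiu418 = stmt-HodgeConjecture-24832; hGnb-CHAIN DESK WORD #2 DEAL C (K2Liu-p23 (g4)), HN2-CENSUS §4 (c-A): the BY-VALUE ∕ BOUND EDITION of
★ `K2LiuRankOneStageValue.exists_normalised_family_value` (F0P2-p11 (g3)).
-/
import Summits.HodgeConjecture.HodgeConjecture.Theorems.K2LiuRankOneStageValue   -- ★ (K1a-3)-VALUE: `exists_normalised_family_value` (+ ★ B7-S, ★ B3, ★ B5a∕b, ★ AllS0, ★ `LocalFieldHaarBalls`)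
import HarnessLib

/-!
# Crux `HLiu418`, road `K2_Liu`, KIND 1 a♮, the `hGnb` road, brick (c-A) — `K2LiuRankOneStageValueBound`:
# ONE RANK-ONE STAGE OF THE COCYCLE — THE PER-POINT LEVEL DATA `(m(g), R(g))` BY VALUE, AND A NORM BOUND FOR THE NORMALISED FAMILY

Cell `hodgecm-mathlib`, crux item hLiu418 = `stmt-HodgeConjecture-24832` (helper lane `--supports … --as helper`, count-neutral); squad K2 ∕ K2Liu via the LH7 fan;
prover LH7-p05 (g4); hGnb-chain desk K2Liu-p23 (g4) DEAL C; census HN2-CENSUS §4 (c-A).  THEOREMS ONLY (no `def`, no `instance`, no notation, no named-fact hypothesis,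
no `sorry`); default heartbeats; currency = ★ `exists_normalised_family_value` VERBATIM (a group `G`, the completion `K_w`, an additive Haar measure `μ`, the rank-one
letters `u ū w₀ ν a c C₀ hrel` of ★ B3, a right level `K′`, a base `q₀` with `q_w = q₀^d`).

THE POINT.  ★ `exists_normalised_family_value` exports the explicit normalised family `N` of one rank-one stage (★ B3's value at the per-point data `(m(g), R(g))` of
★ B7-S `exists_level_and_reps`) only through `∃ N`, with the level `m(g)` and the representatives `R(g)` of `𝔭^{−m(g)} ⧸ 𝔭^{m(g)}` hidden.  The (c) brick of the `hGnb`
road (a SIZE letter for the continued stage families, HN2-CENSUS §4) needs them BY VALUE, with the count `#R(g)`, and a norm bound for `N s g` in terms of the point values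
`Φ_s(w₀ u(b) g)`, `b ∈ R(g)`, and `Φ_s(g)`.  This file re-exports the SAME `N` with:
* §1 (local-field algebra) `card_mul_measureReal_eq_of_cover` — for representatives `R` of `𝔭^n ⧸ 𝔭^r` (★ `exists_finset_primePowBall_eq_biUnion`'s shape):
  `#R · μ(𝔭^r) = μ(𝔭^n)` (★ B5a `integrableOn_and_setIntegral_head_eq_sum` at the constant `1`); `card_eq_pow_of_cover` — for `n = −m`, `r = m`: **`#R = q^{2m}`**
  (★ `measureReal_primePowBall`).
* §2 `norm_normalisedValue_le` — THE BOUND for ★ B3's explicit value, EXACT FOR EVERY `s` (`e = a s + c`, `υ = unramValue ν`, `‖υ‖ ≤ 1`):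
  `‖(1 − υ q^{−(e−1)})·Σ_{b∈R} μ(𝔭^m)·Φ_s(w₀ u(b) g) + C₀(s)·Φ_s(g)·(1 − q⁻¹)·μ(𝒪)·(υ q^{1−e})^{m+1}‖`
  `≤ (1 + q^{1 − re e})·μ(𝔭^m)·Σ_{b∈R} ‖Φ_s(w₀ u(b) g)‖ + ‖C₀(s)‖·‖Φ_s(g)‖·(1 − q⁻¹)·μ(𝒪)·q^{(1 − re e)(m+1)}`,
  and `norm_normalisedValue_le_of_one_le_re` — on `1 ≤ re e` with a sup letter `‖Φ_s(w₀ u(b) g)‖ ≤ B` (`b ∈ R`): `≤ 2·#R·μ(𝔭^m)·B + ‖C₀(s)‖·‖Φ_s(g)‖·(1 − q⁻¹)·μ(𝒪)`.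
* §3 HEAD **`norm_normalised_family_le`** — ★ `exists_normalised_family_value`'s binders VERBATIM; conclusion `∃ (m : G → ℕ) (R : G → Finset K_w) (N : ℂ → G → ℂ)` with
  ★'s clauses (i)(ii)(iii) for `N` VERBATIM, PLUS (iv) the level data by value (`∀ t ∈ 𝔭^{m g}, g⁻¹ u(t) g ∈ K′`, same for `ū`; `↑(R g) ⊆ 𝔭^{−m g}`; pairwise incongruent
  mod `𝔭^{m g}`; `𝔭^{−m g} = ⋃_{a ∈ R g}(a + 𝔭^{m g})`; `#(R g) = q^{2 m g}`; `m g` MINIMAL among the levels of `g` — the hook for (c-C) «level of the translate»),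
  (v) the formula for `N s g` by value, (vi) the exact bound of §2 at `(m g, R g)`, and
  (vi′) its `1 ≤ re(a s + c)` corollary with a sup letter.
HONEST LABEL.  Count-neutral helper, closes no socket; `HC_CM` is proved only modulo the 7 printed citations (2 remaining named inputs: hLiu418 =
`stmt-HodgeConjecture-24832`, h413 = `stmt-HodgeConjecture-24833`) until rung 0 closes.

## References
* [Casselman1980] W. Casselman, *The unramified principal series of p-adic groups I*, Compositio Math. 40 (1980), §3 Thm. 3.1 (rank-one operators at a level).
* [BushnellHenniart2006] C. Bushnell, G. Henniart, *The local Langlands conjecture for GL(2)* (2006), §1.1 (`[𝔭^{−m} : 𝔭^m] = q^{2m}`, `μ(𝔭^m) = q^{−m} μ(𝒪)`).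
* [KudlaSweet1997] S. Kudla, W. J. Sweet, Israel J. Math. 98 (1997), §1.   * [Tate1950] J. Tate (1950), §2.2, §2.5.
-/

set_option autoImplicit false
set_option linter.dupNamespace false -- the mandated namespace repeats `HodgeConjecture.HodgeConjecture`

noncomputable section

open MeasureTheory
open scoped NNReal ENNReal
open NumberField IsDedekindDomain
open Literature.NumberTheory.GaloisRepresentations.IsNonarchimedeanLocalField
open Literature.NumberTheory.Automorphic Literature.NumberTheory.Automorphic.UnitaryGroup Literature.NumberTheory.Automorphic.LocalFieldHaar
open Summit.HodgeConjecture.HodgeConjecture.Cruxes.HLiu418.K2LiuQRationalDefs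
open Summit.HodgeConjecture.HodgeConjecture.Cruxes.HLiu418.K2LiuQRationalLFactor
open Summit.HodgeConjecture.HodgeConjecture.Cruxes.HLiu418.K2LiuLocalLFactorDefs
open Summit.HodgeConjecture.HodgeConjecture.Cruxes.HLiu418.K2LiuRankOneOperators
open Summit.HodgeConjecture.HodgeConjecture.Cruxes.HLiu418.K2LiuRankOneFamiliesBase
open Summit.HodgeConjecture.HodgeConjecture.Cruxes.HLiu418.K2LiuRankOneStage
open Summit.HodgeConjecture.HodgeConjecture.Cruxes.HLiu418.K2LiuA7NormalisedRegularityAllS0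

namespace Summit.HodgeConjecture.HodgeConjecture.Cruxes.HLiu418.K2LiuRankOneStageValueBound

/-! ## §1 Representatives of `𝔭^n ⧸ 𝔭^r`: the count -/

section Count

variable {F : Type*} [Field F] [ValuativeRel F] [TopologicalSpace F] [IsNonarchimedeanLocalField F]
  [MeasurableSpace F] [BorelSpace F]

/-- **`#R · μ(𝔭^r) = μ(𝔭^n)`** for representatives `R` of `𝔭^n` modulo `𝔭^r` (pairwise incongruent, covering — the shape of ★ `exists_finset_primePowBall_eq_biUnion`):
★ B5a `integrableOn_and_setIntegral_head_eq_sum` at the constant function `1`. [cite: BushnellHenniart2006, §1.1] [cite: Tate1950, §2.2] -/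
theorem card_mul_measureReal_eq_of_cover (μ : Measure F) [μ.IsAddHaarMeasure] {n r : ℤ} (R : Finset F) (hRinc : ∀ y ∈ R, ∀ y' ∈ R, y ≠ y' → y - y' ∉ primePowBall F r)
    (hRcov : primePowBall F n = ⋃ y ∈ R, {x : F | x - y ∈ primePowBall F r}) :
    (R.card : ℝ) * μ.real (primePowBall F r) = μ.real (primePowBall F n) := by
  have h := (K2LiuRankOneLevelShells.integrableOn_and_setIntegral_head_eq_sum μ R hRinc hRcov (fun _ => (1 : ℂ)) (fun _ _ _ _ => rfl)).2
  rw [setIntegral_const, Complex.real_smul, mul_one] at h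
  simp only [mul_one, Finset.sum_const, nsmul_eq_mul] at h
  exact_mod_cast h.symm

/-- **`#R = q^{2m}`** for representatives `R` of `𝔭^{−m}` modulo `𝔭^m` (`μ(𝔭^k) = q^{−k} μ(𝒪)`, ★ `measureReal_primePowBall`; `μ(𝒪) > 0`).
[cite: BushnellHenniart2006, §1.1] -/
theorem card_eq_pow_of_cover (μ : Measure F) [μ.IsAddHaarMeasure] (m : ℕ) (R : Finset F) (hRinc : ∀ y ∈ R, ∀ y' ∈ R, y ≠ y' → y - y' ∉ primePowBall F (m : ℤ))
    (hRcov : primePowBall F (-(m : ℤ)) = ⋃ y ∈ R, {x : F | x - y ∈ primePowBall F (m : ℤ)}) :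
    R.card = residueFieldCard F ^ (2 * m) := by
  have h := card_mul_measureReal_eq_of_cover μ R hRinc hRcov
  have hq : (0 : ℝ) < (residueFieldCard F : ℝ) := Nat.cast_pos.2 (Nat.pos_of_ne_zero (residueFieldCard_ne_zero F))
  have hμ0 : 0 < μ.real (primePowBall F 0) := measureReal_primePowBall_pos μ 0
  have hqm : (residueFieldCard F : ℝ) ^ m ≠ 0 := pow_ne_zero _ hq.ne'
  have h1 : ((residueFieldCard F : ℝ)⁻¹) ^ (m : ℤ) = ((residueFieldCard F : ℝ) ^ m)⁻¹ := by rw [inv_zpow, zpow_natCast]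
  have h2 : ((residueFieldCard F : ℝ)⁻¹) ^ (-(m : ℤ)) = (residueFieldCard F : ℝ) ^ m := by rw [zpow_neg, inv_zpow, inv_inv, zpow_natCast]
  rw [measureReal_primePowBall μ (m : ℤ), measureReal_primePowBall μ (-(m : ℤ)), h1, h2] at h
  -- `h : #R · ((q^m)⁻¹ · μ(𝒪)) = q^m · μ(𝒪)`
  have key : (R.card : ℝ) * μ.real (primePowBall F 0) = (residueFieldCard F : ℝ) ^ m * (residueFieldCard F : ℝ) ^ m * μ.real (primePowBall F 0) := by
    have h' : (R.card : ℝ) * (((residueFieldCard F : ℝ) ^ m)⁻¹ * μ.real (primePowBall F 0)) * (residueFieldCard F : ℝ) ^ m =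
        (residueFieldCard F : ℝ) ^ m * μ.real (primePowBall F 0) * (residueFieldCard F : ℝ) ^ m := by rw [h]
    rw [show (R.card : ℝ) * (((residueFieldCard F : ℝ) ^ m)⁻¹ * μ.real (primePowBall F 0)) * (residueFieldCard F : ℝ) ^ m =
        (R.card : ℝ) * μ.real (primePowBall F 0) * (((residueFieldCard F : ℝ) ^ m)⁻¹ * (residueFieldCard F : ℝ) ^ m) by ring,
      inv_mul_cancel₀ hqm, mul_one] at h'
    rw [h']
    ring
  have hR := mul_right_cancel₀ hμ0.ne' key
  rw [← pow_add, ← two_mul] at hR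
  exact_mod_cast hR

end Count

/-! ## §2 The norm bound for ★ B3's explicit normalised value -/

section Bound

variable {K : Type} [Field K] [NumberField K] {w : HeightOneSpectrum (𝓞 K)} {G : Type*} [Group G]
  [MeasurableSpace (w.adicCompletion K)] (μ : Measure (w.adicCompletion K))

/-- **THE NORM BOUND FOR ONE STAGE'S NORMALISED VALUE, EXACT FOR EVERY `s`.**  For ★ B3's explicit value at level data `(m, R)`,
`N = (1 − υ q^{−(e−1)})·Σ_{b∈R} μ(𝔭^m)·Φ_s(w₀ u(b) g) + C₀(s)·Φ_s(g)·(1 − q⁻¹)·μ(𝒪)·(υ q^{1−e})^{m+1}` (`e = a s + c`, `υ = unramValue ν`, `ν` unitary so `‖υ‖ ≤ 1`):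
**`‖N‖ ≤ (1 + q^{1 − re e})·μ(𝔭^m)·Σ_{b∈R}‖Φ_s(w₀ u(b) g)‖ + ‖C₀(s)‖·‖Φ_s(g)‖·(1 − q⁻¹)·μ(𝒪)·q^{(1 − re e)(m+1)}`** — triangle inequality and `‖q^z‖ = q^{re z}`.
[cite: Casselman1980, §3 Thm. 3.1] [cite: Tate1950, §2.5] -/
theorem norm_normalisedValue_le (Φ : ℂ → G → ℂ) (u : w.adicCompletion K → G) (w₀ : G)
    (ν : (w.adicCompletion K)ˣ →* ℂˣ) (hν : ∀ x, ‖((ν x : ℂˣ) : ℂ)‖ = 1) (a : ℕ) (c : ℂ) (C₀ : ℂ → ℂ)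
    (m : ℕ) (R : Finset (w.adicCompletion K)) (s : ℂ) (g : G) :
    ‖(1 - unramValue K w ν * (residueFieldCard (w.adicCompletion K) : ℂ) ^ (-(((a : ℂ) * s + c) - 1))) *
          (∑ b ∈ R, (μ.real (primePowBall (w.adicCompletion K) (m : ℤ)) : ℂ) * Φ s (w₀ * u b * g)) +
        C₀ s * Φ s g * (1 - (residueFieldCard (w.adicCompletion K) : ℂ)⁻¹) * μ.real (primePowBall (w.adicCompletion K) 0) *
          (unramValue K w ν * (residueFieldCard (w.adicCompletion K) : ℂ) ^ (1 - ((a : ℂ) * s + c))) ^ (m + 1)‖ ≤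
      (1 + (residueFieldCard (w.adicCompletion K) : ℝ) ^ (1 - ((a : ℂ) * s + c).re)) * μ.real (primePowBall (w.adicCompletion K) (m : ℤ)) *
          ∑ b ∈ R, ‖Φ s (w₀ * u b * g)‖ +
        ‖C₀ s‖ * ‖Φ s g‖ * (1 - (residueFieldCard (w.adicCompletion K) : ℝ)⁻¹) * μ.real (primePowBall (w.adicCompletion K) 0) *
          (residueFieldCard (w.adicCompletion K) : ℝ) ^ ((1 - ((a : ℂ) * s + c).re) * (m + 1)) := by
  set q : ℕ := residueFieldCard (w.adicCompletion K) with hqdef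
  have hq1 : 1 < q := one_lt_residueFieldCard (w.adicCompletion K)
  have hq0 : 0 < q := by omega
  have hqR : (1 : ℝ) ≤ (q : ℝ) := by exact_mod_cast hq1.le
  have hqpos : (0 : ℝ) < (q : ℝ) := by positivity
  have hυ : ‖unramValue K w ν‖ ≤ 1 := norm_unramValue_le_one hν
  set e : ℂ := (a : ℂ) * s + c with hedef
  -- the head factor `‖1 − υ q^{−(e−1)}‖ ≤ 1 + q^{1 − re e}`
  have hpow1 : ‖(q : ℂ) ^ (-(e - 1))‖ = (q : ℝ) ^ (1 - e.re) := by
    rw [Complex.norm_natCast_cpow_of_pos hq0, Complex.neg_re, Complex.sub_re, Complex.one_re, neg_sub]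
  have hA : ‖1 - unramValue K w ν * (q : ℂ) ^ (-(e - 1))‖ ≤ 1 + (q : ℝ) ^ (1 - e.re) := by
    refine (norm_sub_le _ _).trans ?_
    rw [norm_one, norm_mul, hpow1]
    gcongr
    calc ‖unramValue K w ν‖ * (q : ℝ) ^ (1 - e.re) ≤ 1 * (q : ℝ) ^ (1 - e.re) := by gcongr
      _ = (q : ℝ) ^ (1 - e.re) := one_mul _
  -- the sum
  have hμm : 0 ≤ μ.real (primePowBall (w.adicCompletion K) (m : ℤ)) := measureReal_nonneg
  have hS : ‖∑ b ∈ R, (μ.real (primePowBall (w.adicCompletion K) (m : ℤ)) : ℂ) * Φ s (w₀ * u b * g)‖ ≤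
      μ.real (primePowBall (w.adicCompletion K) (m : ℤ)) * ∑ b ∈ R, ‖Φ s (w₀ * u b * g)‖ := by
    refine (norm_sum_le _ _).trans (le_of_eq ?_)
    rw [Finset.mul_sum]
    refine Finset.sum_congr rfl fun b _ => ?_
    rw [norm_mul, Complex.norm_real, Real.norm_of_nonneg hμm]
  -- the tail term
  have hμ0 : 0 ≤ μ.real (primePowBall (w.adicCompletion K) 0) := measureReal_nonneg
  have hone : ‖(1 : ℂ) - (q : ℂ)⁻¹‖ = 1 - (q : ℝ)⁻¹ := by
    rw [show (1 : ℂ) - (q : ℂ)⁻¹ = (((1 : ℝ) - (q : ℝ)⁻¹ : ℝ) : ℂ) by push_cast; rfl, Complex.norm_real, Real.norm_of_nonneg]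
    rw [sub_nonneg]
    exact inv_le_one_of_one_le₀ hqR
  have hpow2 : ‖(q : ℂ) ^ (1 - e)‖ = (q : ℝ) ^ (1 - e.re) := by
    rw [Complex.norm_natCast_cpow_of_pos hq0, Complex.sub_re, Complex.one_re]
  have htailpow : ‖(unramValue K w ν * (q : ℂ) ^ (1 - e)) ^ (m + 1)‖ ≤ (q : ℝ) ^ ((1 - e.re) * (m + 1)) := by
    rw [norm_pow, norm_mul, hpow2, show ((1 - e.re) * (m + 1) : ℝ) = (1 - e.re) * ((m + 1 : ℕ) : ℝ) by push_cast; ring,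
      Real.rpow_mul_natCast hqpos.le]
    gcongr
    calc ‖unramValue K w ν‖ * (q : ℝ) ^ (1 - e.re) ≤ 1 * (q : ℝ) ^ (1 - e.re) := by gcongr
      _ = (q : ℝ) ^ (1 - e.re) := one_mul _
  have hT : ‖C₀ s * Φ s g * (1 - (q : ℂ)⁻¹) * (μ.real (primePowBall (w.adicCompletion K) 0) : ℂ) *
        (unramValue K w ν * (q : ℂ) ^ (1 - e)) ^ (m + 1)‖ ≤
      ‖C₀ s‖ * ‖Φ s g‖ * (1 - (q : ℝ)⁻¹) * μ.real (primePowBall (w.adicCompletion K) 0) * (q : ℝ) ^ ((1 - e.re) * (m + 1)) := by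
    rw [norm_mul, norm_mul, norm_mul, norm_mul, hone, Complex.norm_real, Real.norm_of_nonneg hμ0]
    exact mul_le_mul_of_nonneg_left htailpow
      (mul_nonneg (mul_nonneg (mul_nonneg (norm_nonneg _) (norm_nonneg _)) (sub_nonneg.2 (inv_le_one_of_one_le₀ hqR))) hμ0)
  -- assemble
  calc _ ≤ ‖(1 - unramValue K w ν * (q : ℂ) ^ (-(e - 1))) * ∑ b ∈ R, (μ.real (primePowBall (w.adicCompletion K) (m : ℤ)) : ℂ) * Φ s (w₀ * u b * g)‖ +
        ‖C₀ s * Φ s g * (1 - (q : ℂ)⁻¹) * (μ.real (primePowBall (w.adicCompletion K) 0) : ℂ) * (unramValue K w ν * (q : ℂ) ^ (1 - e)) ^ (m + 1)‖ :=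
      norm_add_le _ _
    _ ≤ (1 + (q : ℝ) ^ (1 - e.re)) * (μ.real (primePowBall (w.adicCompletion K) (m : ℤ)) * ∑ b ∈ R, ‖Φ s (w₀ * u b * g)‖) +
        ‖C₀ s‖ * ‖Φ s g‖ * (1 - (q : ℝ)⁻¹) * μ.real (primePowBall (w.adicCompletion K) 0) * (q : ℝ) ^ ((1 - e.re) * (m + 1)) :=
      add_le_add ((norm_mul_le _ _).trans (mul_le_mul hA hS (norm_nonneg _) (by positivity))) hT
    _ = _ := by ring

/-- **THE SAME ON `1 ≤ re e`, WITH A SUP LETTER**: if `1 ≤ re(a s + c)` and `‖Φ_s(w₀ u(b) g)‖ ≤ B` for `b ∈ R`, then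
**`‖N‖ ≤ 2·#R·μ(𝔭^m)·B + ‖C₀(s)‖·‖Φ_s(g)‖·(1 − q⁻¹)·μ(𝒪)`** (`q^{1 − re e} ≤ 1`, `q^{(1 − re e)(m+1)} ≤ 1`). [cite: Casselman1980, §3 Thm. 3.1] [cite: Tate1950, §2.5] -/
theorem norm_normalisedValue_le_of_one_le_re (Φ : ℂ → G → ℂ) (u : w.adicCompletion K → G) (w₀ : G)
    (ν : (w.adicCompletion K)ˣ →* ℂˣ) (hν : ∀ x, ‖((ν x : ℂˣ) : ℂ)‖ = 1) (a : ℕ) (c : ℂ) (C₀ : ℂ → ℂ)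
    (m : ℕ) (R : Finset (w.adicCompletion K)) (s : ℂ) (g : G) (hs : 1 ≤ ((a : ℂ) * s + c).re) (B : ℝ)
    (hB : ∀ b ∈ R, ‖Φ s (w₀ * u b * g)‖ ≤ B) :
    ‖(1 - unramValue K w ν * (residueFieldCard (w.adicCompletion K) : ℂ) ^ (-(((a : ℂ) * s + c) - 1))) *
          (∑ b ∈ R, (μ.real (primePowBall (w.adicCompletion K) (m : ℤ)) : ℂ) * Φ s (w₀ * u b * g)) +
        C₀ s * Φ s g * (1 - (residueFieldCard (w.adicCompletion K) : ℂ)⁻¹) * μ.real (primePowBall (w.adicCompletion K) 0) *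
          (unramValue K w ν * (residueFieldCard (w.adicCompletion K) : ℂ) ^ (1 - ((a : ℂ) * s + c))) ^ (m + 1)‖ ≤
      2 * R.card * μ.real (primePowBall (w.adicCompletion K) (m : ℤ)) * B +
        ‖C₀ s‖ * ‖Φ s g‖ * (1 - (residueFieldCard (w.adicCompletion K) : ℝ)⁻¹) * μ.real (primePowBall (w.adicCompletion K) 0) := by
  set q : ℕ := residueFieldCard (w.adicCompletion K) with hqdef
  have hq1 : 1 < q := one_lt_residueFieldCard (w.adicCompletion K)
  have hqR : (1 : ℝ) ≤ (q : ℝ) := by exact_mod_cast hq1.le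
  have h := norm_normalisedValue_le μ Φ u w₀ ν hν a c C₀ m R s g
  have hμm : 0 ≤ μ.real (primePowBall (w.adicCompletion K) (m : ℤ)) := measureReal_nonneg
  have hμ0 : 0 ≤ μ.real (primePowBall (w.adicCompletion K) 0) := measureReal_nonneg
  have hx : (q : ℝ) ^ (1 - ((a : ℂ) * s + c).re) ≤ 1 := Real.rpow_le_one_of_one_le_of_nonpos hqR (by linarith)
  have hx' : (q : ℝ) ^ ((1 - ((a : ℂ) * s + c).re) * (m + 1)) ≤ 1 :=
    Real.rpow_le_one_of_one_le_of_nonpos hqR (mul_nonpos_of_nonpos_of_nonneg (by linarith) (by positivity))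
  have hsum : ∑ b ∈ R, ‖Φ s (w₀ * u b * g)‖ ≤ R.card * B := by
    have := Finset.sum_le_card_nsmul R (fun b => ‖Φ s (w₀ * u b * g)‖) B hB
    rwa [nsmul_eq_mul] at this
  have hsum0 : 0 ≤ ∑ b ∈ R, ‖Φ s (w₀ * u b * g)‖ := Finset.sum_nonneg fun b _ => norm_nonneg _
  have hinv : 0 ≤ 1 - (q : ℝ)⁻¹ := sub_nonneg.2 (inv_le_one_of_one_le₀ hqR)
  refine h.trans ?_
  have h1 : (1 + (q : ℝ) ^ (1 - ((a : ℂ) * s + c).re)) * μ.real (primePowBall (w.adicCompletion K) (m : ℤ)) * ∑ b ∈ R, ‖Φ s (w₀ * u b * g)‖ ≤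
      2 * μ.real (primePowBall (w.adicCompletion K) (m : ℤ)) * (R.card * B) := by
    rw [mul_assoc, mul_assoc]
    exact mul_le_mul (by linarith) (mul_le_mul_of_nonneg_left hsum hμm) (mul_nonneg hμm hsum0) (by norm_num)
  have h2 : ‖C₀ s‖ * ‖Φ s g‖ * (1 - (q : ℝ)⁻¹) * μ.real (primePowBall (w.adicCompletion K) 0) * (q : ℝ) ^ ((1 - ((a : ℂ) * s + c).re) * (m + 1)) ≤
      ‖C₀ s‖ * ‖Φ s g‖ * (1 - (q : ℝ)⁻¹) * μ.real (primePowBall (w.adicCompletion K) 0) * 1 := by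
    gcongr
  calc _ ≤ 2 * μ.real (primePowBall (w.adicCompletion K) (m : ℤ)) * (R.card * B) + ‖C₀ s‖ * ‖Φ s g‖ * (1 - (q : ℝ)⁻¹) * μ.real (primePowBall (w.adicCompletion K) 0) * 1 :=
      add_le_add h1 h2
    _ = _ := by ring

end Bound

/-! ## §3 HEAD: one stage of the cocycle with the level data by value and the bound -/

section Family

variable {K : Type} [Field K] [NumberField K] {w : HeightOneSpectrum (𝓞 K)} {G : Type*} [Group G] [TopologicalSpace G] [IsTopologicalGroup G]
  [MeasurableSpace (w.adicCompletion K)] [BorelSpace (w.adicCompletion K)] (μ : Measure (w.adicCompletion K)) [μ.IsAddHaarMeasure]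

/-- **(c-A) ONE STAGE OF THE COCYCLE — THE LEVEL DATA `(m(g), R(g))` BY VALUE AND THE NORM BOUND** (edition of ★ `exists_normalised_family_value`: SAME binders, SAME
explicit `N`).  `∃ (m : G → ℕ) (R : G → Finset K_w) (N : ℂ → G → ℂ)` with: (i)(ii)(iii) = ★'s three clauses for `N` VERBATIM (regularity at every `s₀` from `C₀` and the
point values; the value identity `∫ Φ_s(w₀ u(x) g) dμ = L(a s + c − 1, ν)·N s g` with integrability on `1 < re s`, and at every convergent point where the two letters hold);
**(iv) for every `g`: `∀ t ∈ 𝔭^{m g}, g⁻¹ u(t) g ∈ K′` and `∀ t ∈ 𝔭^{m g}, g⁻¹ ū(t) g ∈ K′` (★ B3 `exists_level₂`), `↑(R g) ⊆ 𝔭^{−m g}`, the `R g` pairwise incongruent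
mod `𝔭^{m g}`, `𝔭^{−m g} = ⋃_{a ∈ R g} (a + 𝔭^{m g})` (★ `exists_finset_primePowBall_eq_biUnion`), `#(R g) = q_w^{2 m g}` (§1), and MINIMALITY of the level
(`m g ≤ m′` for every level `m′` of `g` w.r.t. `K′` — so a consumer bounds `m g`, hence `#(R g)`, by exhibiting ANY level); (v) the formula
`N s g = (1 − υ q^{−(e−1)})·Σ_{b ∈ R g} μ(𝔭^{m g})·Φ_s(w₀ u(b) g) + C₀(s)·Φ_s(g)·(1 − q⁻¹)·μ(𝒪)·(υ q^{1−e})^{m g+1}` by value; (vi) the exact bound of §2 at `(m g, R g)`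
for every `s`; (vi′) on `1 ≤ re(a s + c)`, with `‖Φ_s(w₀ u(b) g)‖ ≤ B` on `R g`: `‖N s g‖ ≤ 2·#(R g)·μ(𝔭^{m g})·B + ‖C₀(s)‖·‖Φ_s(g)‖·(1 − q⁻¹)·μ(𝒪)`.**
[cite: Casselman1980, §3 Thm. 3.1] [cite: KudlaSweet1997, §1] [cite: BushnellHenniart2006, §1.1] [cite: Tate1950, §2.5] -/
theorem norm_normalised_family_le (Φ : ℂ → G → ℂ) {K' : Subgroup G} (hK' : IsOpen (K' : Set G))
    (hΦK : ∀ s : ℂ, 1 < s.re → ∀ g, ∀ k ∈ K', Φ s (g * k) = Φ s g)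
    {u ū : w.adicCompletion K → G} (hu : Continuous u) (hu0 : u 0 = 1) (hū : Continuous ū) (hū0 : ū 0 = 1) (hu_add : ∀ x t, u (x + t) = u x * u t) (w₀ : G)
    (ν : (w.adicCompletion K)ˣ →* ℂˣ) (hν : ∀ x, ‖((ν x : ℂˣ) : ℂ)‖ = 1) (a : ℕ) (c : ℂ) (he : ∀ s : ℂ, 1 < s.re → 1 < ((a : ℂ) * s + c).re)
    (C₀ : ℂ → ℂ) (q₀ d : ℕ) (hq₀ : q₀ ≠ 0) (hq : residueFieldCard (w.adicCompletion K) = q₀ ^ d)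
    (hrel : ∀ s : ℂ, 1 < s.re → ∀ (x : (w.adicCompletion K)ˣ) (g : G),
      Φ s (w₀ * u x * g) = C₀ s * (((ν x)⁻¹ : ℂˣ) : ℂ) * ((normAbs (w.adicCompletion K) (x : w.adicCompletion K) : ℝ) : ℂ) ^ (-((a : ℂ) * s + c)) *
        Φ s (ū ((x⁻¹ : (w.adicCompletion K)ˣ) : w.adicCompletion K) * g)) :
    ∃ (m : G → ℕ) (R : G → Finset (w.adicCompletion K)) (N : ℂ → G → ℂ),
      (∀ s₀ : ℂ, IsQRationalRegularAt q₀ s₀ C₀ → (∀ g, IsQRationalRegularAt q₀ s₀ fun s => Φ s g) →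
        ∀ g, IsQRationalRegularAt q₀ s₀ fun s => N s g) ∧
      (∀ s : ℂ, 1 < s.re → ∀ g,
        Integrable (fun x => Φ s (w₀ * u x * g)) μ ∧
          ∫ x, Φ s (w₀ * u x * g) ∂μ = lFactor K w ν ((a : ℂ) * s + c - 1) * N s g) ∧
      (∀ (s : ℂ) (g : G), 1 < ((a : ℂ) * s + c).re → (∀ g', ∀ k ∈ K', Φ s (g' * k) = Φ s g') →
        (∀ (x : (w.adicCompletion K)ˣ) (g' : G),
          Φ s (w₀ * u x * g') = C₀ s * (((ν x)⁻¹ : ℂˣ) : ℂ) * ((normAbs (w.adicCompletion K) (x : w.adicCompletion K) : ℝ) : ℂ) ^ (-((a : ℂ) * s + c)) *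
            Φ s (ū ((x⁻¹ : (w.adicCompletion K)ˣ) : w.adicCompletion K) * g')) →
        Integrable (fun x => Φ s (w₀ * u x * g)) μ ∧
          ∫ x, Φ s (w₀ * u x * g) ∂μ = lFactor K w ν ((a : ℂ) * s + c - 1) * N s g) ∧
      (∀ g, (∀ t ∈ primePowBall (w.adicCompletion K) (m g : ℤ), g⁻¹ * u t * g ∈ K') ∧
        (∀ t ∈ primePowBall (w.adicCompletion K) (m g : ℤ), g⁻¹ * ū t * g ∈ K') ∧
        (↑(R g) : Set (w.adicCompletion K)) ⊆ primePowBall (w.adicCompletion K) (-(m g : ℤ)) ∧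
        (∀ a' ∈ R g, ∀ a'' ∈ R g, a' ≠ a'' → a' - a'' ∉ primePowBall (w.adicCompletion K) (m g : ℤ)) ∧
        primePowBall (w.adicCompletion K) (-(m g : ℤ)) = ⋃ a' ∈ R g, {x | x - a' ∈ primePowBall (w.adicCompletion K) (m g : ℤ)} ∧
        (R g).card = residueFieldCard (w.adicCompletion K) ^ (2 * m g) ∧
        (∀ m' : ℕ, (∀ t ∈ primePowBall (w.adicCompletion K) (m' : ℤ), g⁻¹ * u t * g ∈ K') →
          (∀ t ∈ primePowBall (w.adicCompletion K) (m' : ℤ), g⁻¹ * ū t * g ∈ K') → m g ≤ m')) ∧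
      (∀ (s : ℂ) (g : G), N s g =
        (1 - unramValue K w ν * (residueFieldCard (w.adicCompletion K) : ℂ) ^ (-(((a : ℂ) * s + c) - 1))) *
            (∑ b ∈ R g, (μ.real (primePowBall (w.adicCompletion K) (m g : ℤ)) : ℂ) * Φ s (w₀ * u b * g)) +
          C₀ s * Φ s g * (1 - (residueFieldCard (w.adicCompletion K) : ℂ)⁻¹) * μ.real (primePowBall (w.adicCompletion K) 0) *
            (unramValue K w ν * (residueFieldCard (w.adicCompletion K) : ℂ) ^ (1 - ((a : ℂ) * s + c))) ^ (m g + 1)) ∧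
      (∀ (s : ℂ) (g : G), ‖N s g‖ ≤
        (1 + (residueFieldCard (w.adicCompletion K) : ℝ) ^ (1 - ((a : ℂ) * s + c).re)) * μ.real (primePowBall (w.adicCompletion K) (m g : ℤ)) *
            ∑ b ∈ R g, ‖Φ s (w₀ * u b * g)‖ +
          ‖C₀ s‖ * ‖Φ s g‖ * (1 - (residueFieldCard (w.adicCompletion K) : ℝ)⁻¹) * μ.real (primePowBall (w.adicCompletion K) 0) *
            (residueFieldCard (w.adicCompletion K) : ℝ) ^ ((1 - ((a : ℂ) * s + c).re) * (m g + 1))) ∧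
      ∀ (s : ℂ) (g : G) (B : ℝ), 1 ≤ ((a : ℂ) * s + c).re → (∀ b ∈ R g, ‖Φ s (w₀ * u b * g)‖ ≤ B) →
        ‖N s g‖ ≤ 2 * (R g).card * μ.real (primePowBall (w.adicCompletion K) (m g : ℤ)) * B +
          ‖C₀ s‖ * ‖Φ s g‖ * (1 - (residueFieldCard (w.adicCompletion K) : ℝ)⁻¹) * μ.real (primePowBall (w.adicCompletion K) 0) := by
  -- the per-point data, chosen once (independently of `s`), WITH the inclusion `R ⊆ 𝔭^{−m}`
  have hdata : ∀ y : G, ∃ (m : ℕ) (R : Finset (w.adicCompletion K)),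
      (∀ t ∈ primePowBall (w.adicCompletion K) (m : ℤ), y⁻¹ * u t * y ∈ K') ∧
      (∀ t ∈ primePowBall (w.adicCompletion K) (m : ℤ), y⁻¹ * ū t * y ∈ K') ∧
      (↑R : Set (w.adicCompletion K)) ⊆ primePowBall (w.adicCompletion K) (-(m : ℤ)) ∧
      (∀ a' ∈ R, ∀ a'' ∈ R, a' ≠ a'' → a' - a'' ∉ primePowBall (w.adicCompletion K) (m : ℤ)) ∧
      primePowBall (w.adicCompletion K) (-(m : ℤ)) = ⋃ a' ∈ R, {x | x - a' ∈ primePowBall (w.adicCompletion K) (m : ℤ)} ∧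
      (∀ m' : ℕ, (∀ t ∈ primePowBall (w.adicCompletion K) (m' : ℤ), y⁻¹ * u t * y ∈ K') →
        (∀ t ∈ primePowBall (w.adicCompletion K) (m' : ℤ), y⁻¹ * ū t * y ∈ K') → m ≤ m') := fun y => by
    classical
    -- the MINIMAL level (so that any level a consumer exhibits bounds `m` from above), then representatives at that level
    have hex : ∃ m' : ℕ, (∀ t ∈ primePowBall (w.adicCompletion K) (m' : ℤ), y⁻¹ * u t * y ∈ K') ∧
        (∀ t ∈ primePowBall (w.adicCompletion K) (m' : ℤ), y⁻¹ * ū t * y ∈ K') := exists_level₂ u ū hu hu0 hū hū0 K' hK' y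
    obtain ⟨R, hRsub, hRinc, hRcov⟩ :=
      exists_finset_primePowBall_eq_biUnion (F := w.adicCompletion K) (j := -(Nat.find hex : ℤ)) (r := (Nat.find hex : ℤ)) (by omega)
    exact ⟨Nat.find hex, R, (Nat.find_spec hex).1, (Nat.find_spec hex).2, hRsub, hRinc, hRcov, fun m' h₁ h₂ => Nat.find_min' hex ⟨h₁, h₂⟩⟩
  choose m R hmu hmū hRsub hRinc hRcov hmin using hdata
  refine ⟨m, R, fun s g =>
      (1 - unramValue K w ν * (residueFieldCard (w.adicCompletion K) : ℂ) ^ (-(((a : ℂ) * s + c) - 1))) *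
          (∑ b ∈ R g, (μ.real (primePowBall (w.adicCompletion K) (m g : ℤ)) : ℂ) * Φ s (w₀ * u b * g)) +
        C₀ s * Φ s g * (1 - (residueFieldCard (w.adicCompletion K) : ℂ)⁻¹) * μ.real (primePowBall (w.adicCompletion K) 0) *
          (unramValue K w ν * (residueFieldCard (w.adicCompletion K) : ℂ) ^ (1 - ((a : ℂ) * s + c))) ^ (m g + 1),
    fun s₀ hC₀ hreg g => isQRationalRegularAt_normalised_base_at μ q₀ d hq₀ hq Φ w₀ g ν a c C₀ (m g) (R g) s₀ hC₀ (hreg g) fun b _ => hreg _,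
    fun s hs g => ?_, fun s g hes hK hrels => ?_,
    fun g => ⟨hmu g, hmū g, hRsub g, hRinc g, hRcov g, card_eq_pow_of_cover μ (m g) (R g) (hRinc g) (hRcov g), hmin g⟩,
    fun s g => rfl, fun s g => norm_normalisedValue_le μ Φ u w₀ ν hν a c C₀ (m g) (R g) s g,
    fun s g B hs hB => norm_normalisedValue_le_of_one_le_re μ Φ u w₀ ν hν a c C₀ (m g) (R g) s g hs B hB⟩
  · exact ⟨(integrable_and_integral_eq μ (hΦK s hs) hu_add w₀ ν hν _ (C₀ s) (he s hs) (hrel s hs) g (m g) (hmu g) (hmū g) (R g) (hRinc g) (hRcov g)).1,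
      integral_eq_lFactor_mul_normalised μ (hΦK s hs) hu_add w₀ ν hν _ (C₀ s) (he s hs) (hrel s hs) g (m g) (hmu g) (hmū g) (R g) (hRinc g) (hRcov g)⟩
  · exact ⟨(integrable_and_integral_eq μ hK hu_add w₀ ν hν _ (C₀ s) hes hrels g (m g) (hmu g) (hmū g) (R g) (hRinc g) (hRcov g)).1,
      integral_eq_lFactor_mul_normalised μ hK hu_add w₀ ν hν _ (C₀ s) hes hrels g (m g) (hmu g) (hmū g) (R g) (hRinc g) (hRcov g)⟩

end Family

end Summit.HodgeConjecture.HodgeConjecture.Cruxes.HLiu418.K2LiuRankOneStageValueBound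

end
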